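import Literature.IUT.HodgeTheaters.ProfiniteCompletionQuotients
import Mathlib.Topology.DenseEmbedding
import HarnessLib

/-!
# [IUTchI] §2 plumbing, II: closures of subgroups in `F̂` and the comparison `Ĝ ≅ closure(G) ⊆ F̂`
# for a subgroup `G ⊆ F` of finite index

Mochizuki, *Inter-universal Teichmüller theory I*, §2, Theorem 2.6 and its proof (kurims May-2020
manuscript pp. 56–57): "we shall write `H, G ⊆ F ⊆ F̂`" (statement, p. 56), and in the proof (p. 57)
"`Ĥ_G` for the closure of `H_G` in the profinite completion `Ĝ` of `G`", "by multiplying `γ` on the left by an appropriate element of `F`, we may assume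
that `γ ∈ Ĝ`.  Thus, we have `γ · H_G · γ⁻¹ ⊆ F ∩ Ĝ = G`", "`γ ∈ G · N_Ĝ(H_G) = G · Ĥ_G ⊆ F · N_F̂(H_G)`".
These steps silently use the standard comparison, for a subgroup `G ⊆ F` OF FINITE INDEX, between the
profinite completion `Ĝ` of `G` and the closure of (the image of) `G` in `F̂`.  Over the owner's
typing (`profiniteCompletion`, `toCompletion` of `DiscreteProfiniteConjugates.lean`, abc-iut-L5-t1) and
part I (`ProfiniteCompletionQuotients.lean`), this file PROVES [cite: Mochizuki2012, Thm 2.6 p.57]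
(D-0012 claim key, status disputed — the content is plain profinite group theory and takes no side):

* `mem_closure_image_of_forall_val_mem` / `mem_closure_image_iff_forall` — "the closure `Ĥ`": for ANY
  subgroup `H ⊆ F`, `x ∈ closure(η(H)) ↔ ∀ N, x.val N ∈ H·N/N` (density argument in the limit topology);
* `mem_closure_image_iff_val_mem` — when `H ⊇ N₀` for some finite-index normal `N₀`, ONE level suffices:
  `x ∈ closure(η(H)) ↔ x.val N₀ ∈ H/N₀`;
* `exists_inv_mul_mem_closure` — "multiplying `γ` on the left by an element of `F`, we may assume
  `γ ∈ Ĝ`": `F̂ = η(F) · closure(η(G))` for `[G.FiniteIndex]`;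
* `toCompletion_mem_closure_image_iff` — "`F ∩ Ĝ = G`": `η f ∈ closure(η(G)) ↔ f ∈ G` for
  `[G.FiniteIndex]` (no residual finiteness needed);
* `exists_comparison` — "`Ĝ ⊆ F̂`": for `[G.FiniteIndex]` there is a continuous INJECTIVE homomorphism
  `ι : Ĝ → F̂` with `ι ∘ η_G = η_F|_G` and `range ι = closure(η_F(G))` (`ι` is Mathlib's universal arrow
  `ProfiniteGrp.ProfiniteCompletion.lift`; injectivity via `normalCore` and the density/uniqueness
  principle into the finite quotients `F ⧸ N`; the range via compactness and density).  This is what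
  allows statements typed over `profiniteCompletion G` (Lemma 2.7 (v)–(vii)) to be used inside `F̂`.
-/

namespace Literature.IUT.HodgeTheaters.ProfiniteCompletion

open CategoryTheory ProfiniteGrp ProfiniteGrp.ProfiniteCompletion Topology

universe u

variable {F : Type u} [Group F]

/-! ### The closure of `η(H)` for an arbitrary subgroup `H ⊆ F` -/

/-- **Density argument.** If every component of `x ∈ F̂` lies in the image of the subgroup `H`, then `x`
lies in the closure of `η(H)`: a basic neighbourhood of `x` is determined by finitely many levels
`N₁, …, N_r`, and `η(h)` with `h·M = x.val M`, `M = ⋂ N_j`, lies in it ("`Ĥ` = the closure of `H`",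
p. 57). [cite: Mochizuki2012, Thm 2.6 p.57] -/
theorem mem_closure_image_of_forall_val_mem {H : Subgroup F} {x : profiniteCompletion F}
    (hx : ∀ N : FiniteIndexNormalSubgroup F, x.val N ∈ H.map (QuotientGroup.mk' N.toSubgroup)) :
    x ∈ closure (toCompletion F '' (H : Set F)) := by
  classical
  rw [mem_closure_iff]
  rintro U ⟨s, hsO, rfl⟩ hxU
  change x.val ∈ s at hxU
  rcases isOpen_pi_iff.mp hsO _ hxU with ⟨J, u, hJ1, hJ2⟩
  -- the finite intersection `M` of the levels in `J`
  let M : Subgroup F := ⨅ j : J, (j : FiniteIndexNormalSubgroup F).toSubgroup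
  have hM : M.Normal := Subgroup.normal_iInf_normal fun j => inferInstance
  have hMFinite : M.FiniteIndex := by
    apply Subgroup.finiteIndex_iInf
    infer_instance
  let Mf : FiniteIndexNormalSubgroup F := { toSubgroup := M }
  obtain ⟨h, hh, hhx⟩ := Subgroup.mem_map.mp (hx Mf)
  refine ⟨toCompletion F h, ?_, h, hh, rfl⟩
  change (toCompletion F h).val ∈ s
  apply hJ2
  intro a ha
  have hle : Mf ≤ a := fun y hy =>
    (iInf_le (fun j : J => (j : FiniteIndexNormalSubgroup F).toSubgroup) ⟨a, ha⟩ : M ≤ a.toSubgroup) hy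
  have hxa : (toCompletion F h).val a = x.val a := by
    rw [← x.property (homOfLE hle), ← hhx]
    rfl
  rw [hxa]
  exact (hJ1 a ha).2

/-- `x ∈ closure(η(H))` iff every component of `x` lies in the image `H·N/N` of `H`.
[cite: Mochizuki2012, Thm 2.6 p.57] -/
theorem mem_closure_image_iff_forall {H : Subgroup F} {x : profiniteCompletion F} :
    x ∈ closure (toCompletion F '' (H : Set F)) ↔
      ∀ N : FiniteIndexNormalSubgroup F, x.val N ∈ H.map (QuotientGroup.mk' N.toSubgroup) :=
  ⟨fun hx N => val_mem_map_of_mem_closure hx N, mem_closure_image_of_forall_val_mem⟩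

/-- **One level suffices above a finite-index normal subgroup.** If `N₀ ⊆ H` with `N₀ ⊴ F` of finite
index, then `x ∈ closure(η(H)) ↔ x.val N₀ ∈ H/N₀`. [cite: Mochizuki2012, Thm 2.6 p.57] -/
theorem mem_closure_image_iff_val_mem {H : Subgroup F} (N₀ : FiniteIndexNormalSubgroup F)
    (hN₀ : N₀.toSubgroup ≤ H) (x : profiniteCompletion F) :
    x ∈ closure (toCompletion F '' (H : Set F)) ↔
      x.val N₀ ∈ H.map (QuotientGroup.mk' N₀.toSubgroup) := by
  refine ⟨fun hx => val_mem_map_of_mem_closure hx N₀, fun hx => ?_⟩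
  refine mem_closure_image_of_forall_val_mem fun N => ?_
  -- compare at the common refinement `N ⊓ N₀`
  obtain ⟨g, hg⟩ := QuotientGroup.mk_surjective (x.val (N ⊓ N₀))
  have h0 : x.val N₀ = QuotientGroup.mk g := val_mk_eq_of_le x inf_le_right g hg.symm
  have hN : x.val N = QuotientGroup.mk g := val_mk_eq_of_le x inf_le_left g hg.symm
  -- `g ∈ H` since `x.val N₀ = g·N₀ ∈ H/N₀` and `N₀ ⊆ H`
  obtain ⟨h, hh, hhg⟩ := Subgroup.mem_map.mp hx
  have e : (QuotientGroup.mk h : F ⧸ N₀.toSubgroup) = QuotientGroup.mk g := hhg.trans h0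
  rw [QuotientGroup.eq] at e
  have hgH : g ∈ H := by
    have := H.mul_mem hh (hN₀ e)
    rwa [mul_inv_cancel_left] at this
  exact Subgroup.mem_map.mpr ⟨g, hgH, hN.symm⟩

/-! ### Subgroups of finite index: `F̂ = F · Ĝ` and `F ∩ Ĝ = G` -/

/-- **"By multiplying `γ` on the left by an appropriate element of `F`, we may assume `γ ∈ Ĝ`"** (p. 57):
for `G ⊆ F` of finite index, every `x ∈ F̂` is `η(f) · y` with `f ∈ F` and `y` in the closure of `η(G)`.
[cite: Mochizuki2012, Thm 2.6 p.57] -/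
theorem exists_inv_mul_mem_closure (G : Subgroup F) [G.FiniteIndex] (x : profiniteCompletion F) :
    ∃ f : F, (toCompletion F f)⁻¹ * x ∈ closure (toCompletion F '' (G : Set F)) := by
  let N₀ : FiniteIndexNormalSubgroup F := FiniteIndexNormalSubgroup.ofSubgroup G.normalCore
  obtain ⟨f, hf⟩ := QuotientGroup.mk_surjective (x.val N₀)
  refine ⟨f, (mem_closure_image_iff_val_mem N₀ G.normalCore_le _).mpr ?_⟩
  have h1 : ((toCompletion F f)⁻¹ * x).val N₀ = 1 := by
    change ((toCompletion F f).val N₀)⁻¹ * x.val N₀ = 1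
    rw [← hf]
    exact inv_mul_cancel _
  rw [h1]
  exact one_mem _

/-- **"`F ∩ Ĝ = G`"** (p. 57): for `G ⊆ F` of finite index, `η(f)` lies in the closure of `η(G)` iff
`f ∈ G` (no residual finiteness of `F` is needed). [cite: Mochizuki2012, Thm 2.6 p.57] -/
theorem toCompletion_mem_closure_image_iff (G : Subgroup F) [G.FiniteIndex] (f : F) :
    toCompletion F f ∈ closure (toCompletion F '' (G : Set F)) ↔ f ∈ G := by
  refine ⟨fun hf => ?_, fun hf => subset_closure ⟨f, hf, rfl⟩⟩
  let N₀ : FiniteIndexNormalSubgroup F := FiniteIndexNormalSubgroup.ofSubgroup G.normalCore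
  have h := (mem_closure_image_iff_val_mem N₀ G.normalCore_le _).mp hf
  obtain ⟨g, hg, hgf⟩ := Subgroup.mem_map.mp h
  change (QuotientGroup.mk g : F ⧸ G.normalCore) = QuotientGroup.mk f at hgf
  rw [QuotientGroup.eq] at hgf
  have := G.mul_mem hg (G.normalCore_le hgf)
  rwa [mul_inv_cancel_left] at this

/-- Intersections with `η(F)`: for `G ⊆ F` of finite index, `η(F) ∩ closure(η(G)) = η(G)`.
[cite: Mochizuki2012, Thm 2.6 p.57] -/
theorem range_inter_closure_image (G : Subgroup F) [G.FiniteIndex] :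
    Set.range (toCompletion F) ∩ closure (toCompletion F '' (G : Set F)) =
      toCompletion F '' (G : Set F) := by
  ext x
  constructor
  · rintro ⟨⟨f, rfl⟩, hx⟩
    exact ⟨f, (toCompletion_mem_closure_image_iff G f).mp hx, rfl⟩
  · rintro ⟨f, hf, rfl⟩
    exact ⟨⟨f, rfl⟩, subset_closure ⟨f, hf, rfl⟩⟩

/-! ### The comparison `Ĝ ≅ closure(η_F(G)) ⊆ F̂` -/

/-- **"`Ĝ ⊆ F̂`"** (p. 57).  For a subgroup `G ⊆ F` of finite index there is a continuous injective
homomorphism `ι : Ĝ → F̂` compatible with `η_G`, `η_F` whose image is the closure of `η_F(G)`; `ι` is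
the universal arrow `ProfiniteGrp.ProfiniteCompletion.lift` of `η_F ∘ (G ⊆ F)`.  (Being a continuous
injection from a compact space to a Hausdorff space, `ι` is moreover a closed embedding, i.e. a
topological-group isomorphism onto `closure(η_F(G))`.) [cite: Mochizuki2012, Thm 2.6 p.57] -/
theorem exists_comparison (G : Subgroup F) [G.FiniteIndex] :
    ∃ ι : profiniteCompletion G →* profiniteCompletion F,
      Continuous ι ∧ Function.Injective ι ∧
      (∀ g : G, ι (toCompletion G g) = toCompletion F (g : F)) ∧
      Set.range ι = closure (toCompletion F '' (G : Set F)) := by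
  classical
  -- the universal arrow
  let fG : GrpCat.of (G : Type u) ⟶ GrpCat.of (profiniteCompletion F) :=
    GrpCat.ofHom ((toCompletion F).comp G.subtype)
  let ιh : profiniteCompletion G ⟶ profiniteCompletion F :=
    ProfiniteCompletion.lift (G := GrpCat.of (G : Type u)) (P := profiniteCompletion F) fG
  let ι : profiniteCompletion G →* profiniteCompletion F := ιh.hom.toMonoidHom
  have hcont : Continuous ι := ιh.hom.continuous_toFun
  have hcomm : ∀ g : G, ι (toCompletion G g) = toCompletion F (g : F) := fun g =>
    ConcreteCategory.congr_hom (ProfiniteCompletion.lift_eta fG) g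
  have hdense : DenseRange (toCompletion (G : Type u)) := denseRange (GrpCat.of (G : Type u))
  -- injectivity
  have hinj : Function.Injective ι := by
    rw [injective_iff_map_eq_one]
    intro x hx
    by_contra hne
    -- a level `M` of `Ĝ` at which `x` is nontrivial
    obtain ⟨M, hM⟩ : ∃ M : FiniteIndexNormalSubgroup G, x.val M ≠ 1 := by
      by_contra hall
      push Not at hall
      exact hne (ProfiniteGrp.limit_ext _ _ _ fun M => by rw [hall M]; rfl)
    -- a finite-index normal subgroup `N ⊴ F` with `N ∩ G ⊆ M`
    let M' : Subgroup F := M.toSubgroup.map G.subtype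
    haveI : M'.FiniteIndex := ⟨by
      rw [Subgroup.index_map_subtype]
      exact mul_ne_zero Subgroup.FiniteIndex.index_ne_zero Subgroup.FiniteIndex.index_ne_zero⟩
    let Nf : FiniteIndexNormalSubgroup F := FiniteIndexNormalSubgroup.ofSubgroup M'.normalCore
    let NG : FiniteIndexNormalSubgroup G := Nf.comap G.subtype
    have hNGM : NG ≤ M := by
      intro g hg
      have hg' : (g : F) ∈ M' := M'.normalCore_le hg
      obtain ⟨m, hm, hmg⟩ := Subgroup.mem_map.mp hg'
      rw [← Subtype.ext hmg]
      exact hm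
    -- two continuous homomorphisms `Ĝ → F ⧸ N` agreeing on `η_G(G)`
    haveI : DiscreteTopology ((diagram (GrpCat.of (G : Type u))).obj NG) := ⟨rfl⟩
    let φ₁ : profiniteCompletion G → (diagram (GrpCat.of F)).obj Nf := fun y => (ι y).val Nf
    let j : (diagram (GrpCat.of (G : Type u))).obj NG →* (diagram (GrpCat.of F)).obj Nf :=
      QuotientGroup.map NG.toSubgroup Nf.toSubgroup G.subtype le_rfl
    let φ₂ : profiniteCompletion G → (diagram (GrpCat.of F)).obj Nf := fun y => j (y.val NG)
    have hφ₁ : Continuous φ₁ := (continuous_val Nf).comp hcont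
    have hφ₂ : Continuous φ₂ :=
      (continuous_of_discreteTopology (f := (j : _ → _))).comp (continuous_val NG)
    have heq : φ₁ = φ₂ := by
      refine hdense.equalizer hφ₁ hφ₂ (funext fun g => ?_)
      change (ι (toCompletion G g)).val Nf = j ((toCompletion G g).val NG)
      rw [hcomm]
      rfl
    have h1 : φ₁ x = 1 := by
      change (ι x).val Nf = 1
      rw [hx]
      rfl
    rw [heq] at h1
    -- hence `x.val NG = 1`, hence `x.val M = 1`
    obtain ⟨g, hg⟩ := QuotientGroup.mk_surjective (x.val NG)
    have h2 : j (QuotientGroup.mk g) = 1 := by rw [hg]; exact h1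
    change (QuotientGroup.mk (g : F) : F ⧸ Nf.toSubgroup) = 1 at h2
    rw [QuotientGroup.eq_one_iff] at h2
    have hgNG : g ∈ NG := h2
    have hxM : x.val M = QuotientGroup.mk g := val_mk_eq_of_le x hNGM g hg.symm
    have hM' : ¬ ((QuotientGroup.mk g : G ⧸ M.toSubgroup) = 1) := by rw [← hxM]; exact hM
    rw [QuotientGroup.eq_one_iff] at hM'
    exact hM' (hNGM hgNG)
  -- the range
  have hsub : toCompletion F '' (G : Set F) ⊆ Set.range ι := by
    rintro _ ⟨g, hg, rfl⟩
    exact ⟨toCompletion G ⟨g, hg⟩, hcomm ⟨g, hg⟩⟩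
  have hrange : Set.range ι = closure (toCompletion F '' (G : Set F)) := by
    refine Set.Subset.antisymm ?_ (closure_minimal hsub (isCompact_range hcont).isClosed)
    rintro _ ⟨y, rfl⟩
    refine map_mem_closure hcont (hdense.closure_range ▸ Set.mem_univ y) ?_
    rintro _ ⟨g, rfl⟩
    exact ⟨g, g.property, (hcomm g).symm⟩
  exact ⟨ι, hcont, hinj, hcomm, hrange⟩

end Literature.IUT.HodgeTheaters.ProfiniteCompletion
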